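import Summits.CriticalPhenomena.PercolationContinuityZ3.Theorems.Transplant.PlanarSkeletonFrmColumns
import HarnessLib

/-!
# Φ2 at the interface level, II: the UP-POINTER, APEXES and THREADS of a column matching

builds on p205010 (kernel theorem, internal audit signed; external expert review pending) — nothing in this file uses p205010; nothing
here is a claim about the open node `SamePDropOfSkeletonFrm₁`.
Lane `prim-bschramm`, seat `prim-bschramm-p4` gen 14 (PART C3 of `P4-GENERAL.md`, §36).  Helper file
(`--supports stmt-CriticalPhenomena-4575 --as helper`).  Pure combinatorics over a `ColData` (file I); no probability.

From a column matching `C : Φ.ColData t ℓ` (every slab vertex above the floor matched injectively to a down-neighbour `C.g w`):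
* the UP-POINTER `C.up w` — the matched partner above `w` if `w` is matched from above, else (below the ceiling) any up-neighbour, else `w`;
  it raises `φ₀` by one inside the slab and fixes the ceiling and everything off the slab (`up_spec`, `up_eq_self_of_ge`, `up_g`);
* the APEX `C.apex w = up^{2ℓ+4} w` — the ceiling vertex above `w`; constant along `up` and along `g` (`apex_up`, `apex_g`): the fibres of
  `apex` are the finite COLUMN CLASSES of the exhaustion in file V (finite because every class vertex is within `2ℓ+4` of its apex);
* THREADS: from every slab vertex an UP-thread to its apex and a DOWN-thread to the floor, both paths of length `≤ 2ℓ+4`, `φ₁` constant,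
  `φ₀` monotone, INSIDE THE CLASS (`exists_upWalk`, `exists_downWalk`) — the kit columns of file IV.
This is the graph-level replacement of the right `⟨s₀⟩`-cosets of the Cayley construction (`CayleyCylinderStrict` §1, gen 10).
[cite: AizenmanGrimmett1991, Thm 1 (essential enhancements)] [cite: KozmaNitzan2024, §4 p. 15 (boxes and their translates)]
-/

noncomputable section

namespace Summit.CriticalPhenomena.PercolationContinuityZ3.Theorems.Transplant

namespace PlanarSkeletonFrm

open SimpleGraph Walk Literature.Probability.LatticeModels
open scoped Classical

variable {V : Type} {G : SimpleGraph V} [G.LocallyFinite] {Φ : PlanarSkeletonFrm G}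

namespace ColData

variable {t : V} {ℓ : ℕ} (C : Φ.ColData t ℓ)

/-! ## §1 The up-pointer -/

/-- **The up-pointer**: the vertex matched down onto `w` if any; otherwise an up-neighbour (below the ceiling of the slab); otherwise `w`.
[folklore] -/
def up (w : V) : V :=
  if h : ∃ v, v ∈ Φ.dom t ℓ ∧ C.g v = w then h.choose
  else if w ∈ Φ.slab t ℓ ∧ Φ.φ w 0 - Φ.φ t 0 < (ℓ : ℤ) + 2 then (Φ.upNbrs_nonempty w).choose
  else w

/-- The up-pointer inverts the matching: `up (g v) = v`. [folklore] -/
theorem up_g {v : V} (hv : v ∈ Φ.dom t ℓ) : C.up (C.g v) = v := by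
  have h : ∃ v', v' ∈ Φ.dom t ℓ ∧ C.g v' = C.g v := ⟨v, hv, rfl⟩
  rw [up, dif_pos h]
  exact C.g_inj h.choose_spec.1 hv h.choose_spec.2

/-- **Below the ceiling the up-pointer is an up-neighbour.** [folklore] -/
theorem up_spec {w : V} (hw : w ∈ Φ.slab t ℓ) (hlt : Φ.φ w 0 - Φ.φ t 0 < (ℓ : ℤ) + 2) : C.up w ∈ Φ.upNbrs w := by
  unfold up
  split_ifs with h h'
  · obtain ⟨hv, hgv⟩ := h.choose_spec
    have := C.mem_upNbrs_g hv
    rwa [hgv] at this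
  · exact (Φ.upNbrs_nonempty w).choose_spec
  · exact absurd ⟨hw, hlt⟩ h'

/-- Below the ceiling: `up w ~ w`. [folklore] -/
theorem adj_up {w : V} (hw : w ∈ Φ.slab t ℓ) (hlt : Φ.φ w 0 - Φ.φ t 0 < (ℓ : ℤ) + 2) : G.Adj w (C.up w) :=
  (Φ.mem_upNbrs.1 (C.up_spec hw hlt)).1

/-- Below the ceiling: coordinates of `up w`. [folklore] -/
theorem φ_up {w : V} (hw : w ∈ Φ.slab t ℓ) (hlt : Φ.φ w 0 - Φ.φ t 0 < (ℓ : ℤ) + 2) :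
    Φ.φ (C.up w) 0 = Φ.φ w 0 + 1 ∧ Φ.φ (C.up w) 1 = Φ.φ w 1 := Φ.φ_of_mem_upNbrs (C.up_spec hw hlt)

/-- Below the ceiling: `up w` lies in the matching domain (hence in the slab). [folklore] -/
theorem up_mem_dom {w : V} (hw : w ∈ Φ.slab t ℓ) (hlt : Φ.φ w 0 - Φ.φ t 0 < (ℓ : ℤ) + 2) : C.up w ∈ Φ.dom t ℓ :=
  Φ.upNbrs_mem_dom hw hlt (C.up_spec hw hlt)

/-- At or above the ceiling the up-pointer is the identity. [folklore] -/
theorem up_eq_self_of_ge {w : V} (hge : (ℓ : ℤ) + 2 ≤ Φ.φ w 0 - Φ.φ t 0) : C.up w = w := by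
  unfold up
  split_ifs with h h'
  · exfalso
    obtain ⟨v, hv, hgv⟩ := h
    have h0 := (C.φ_g hv).1
    have hs := (Φ.mem_slab.1 hv.1).1
    rw [abs_le] at hs
    rw [hgv] at h0
    omega
  · exfalso; omega
  · rfl

/-- Off the slab the up-pointer is the identity. [folklore] -/
theorem up_eq_self_of_not_mem {w : V} (hw : w ∉ Φ.slab t ℓ) : C.up w = w := by
  unfold up
  split_ifs with h h'
  · exfalso
    obtain ⟨v, hv, hgv⟩ := h
    exact hw (hgv ▸ C.g_mem_slab hv)
  · exact absurd h'.1 hw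
  · rfl

/-- The up-pointer preserves the slab. [folklore] -/
theorem up_mem_slab {w : V} (hw : w ∈ Φ.slab t ℓ) : C.up w ∈ Φ.slab t ℓ := by
  by_cases hlt : Φ.φ w 0 - Φ.φ t 0 < (ℓ : ℤ) + 2
  · exact (C.up_mem_dom hw hlt).1
  · rw [C.up_eq_self_of_ge (not_lt.1 hlt)]; exact hw

/-! ## §2 Iterates and the apex -/

/-- Iterates of the up-pointer stay in the slab. [folklore] -/
theorem iterate_up_mem_slab {w : V} (hw : w ∈ Φ.slab t ℓ) (k : ℕ) : C.up^[k] w ∈ Φ.slab t ℓ := by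
  induction k with
  | zero => exact hw
  | succ k ih => rw [Function.iterate_succ_apply']; exact C.up_mem_slab ih

/-- Iterates of the up-pointer keep `φ₁`. [folklore] -/
theorem φ1_iterate_up {w : V} (hw : w ∈ Φ.slab t ℓ) (k : ℕ) : Φ.φ (C.up^[k] w) 1 = Φ.φ w 1 := by
  induction k with
  | zero => rfl
  | succ k ih =>
    rw [Function.iterate_succ_apply']
    have hu := C.iterate_up_mem_slab hw k
    by_cases hlt : Φ.φ (C.up^[k] w) 0 - Φ.φ t 0 < (ℓ : ℤ) + 2
    · rw [(C.φ_up hu hlt).2, ih]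
    · rw [C.up_eq_self_of_ge (not_lt.1 hlt), ih]

/-- Iterates of the up-pointer raise `φ₀` by one per step until the ceiling. [folklore] -/
theorem φ0_iterate_up {w : V} (hw : w ∈ Φ.slab t ℓ) (k : ℕ) :
    Φ.φ (C.up^[k] w) 0 - Φ.φ t 0 = min (Φ.φ w 0 - Φ.φ t 0 + k) ((ℓ : ℤ) + 2) := by
  induction k with
  | zero =>
    have h := (Φ.mem_slab.1 hw).1; rw [abs_le] at h
    simp only [Function.iterate_zero, id_eq, Nat.cast_zero, add_zero]
    exact (min_eq_left h.2).symm
  | succ k ih =>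
    rw [Function.iterate_succ_apply']
    have hu := C.iterate_up_mem_slab hw k
    by_cases hlt : Φ.φ (C.up^[k] w) 0 - Φ.φ t 0 < (ℓ : ℤ) + 2
    · rw [(C.φ_up hu hlt).1]
      rw [ih] at hlt
      have e : Φ.φ (C.up^[k] w) 0 + 1 - Φ.φ t 0 = (Φ.φ (C.up^[k] w) 0 - Φ.φ t 0) + 1 := by ring
      rw [e, ih]
      push_cast
      omega
    · rw [C.up_eq_self_of_ge (not_lt.1 hlt), ih]
      rw [ih] at hlt
      push_cast
      omega

/-- **The apex** of `w`: the ceiling vertex reached by `2ℓ+4` up-pointer steps. [folklore] -/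
def apex (w : V) : V := C.up^[2 * ℓ + 4] w

/-- The apex of a slab vertex lies in the slab. [folklore] -/
theorem apex_mem_slab {w : V} (hw : w ∈ Φ.slab t ℓ) : C.apex w ∈ Φ.slab t ℓ := C.iterate_up_mem_slab hw _

/-- The apex of a slab vertex is on the ceiling `φ₀ − φ₀(t) = ℓ + 2`. [folklore] -/
theorem φ0_apex {w : V} (hw : w ∈ Φ.slab t ℓ) : Φ.φ (C.apex w) 0 - Φ.φ t 0 = (ℓ : ℤ) + 2 := by
  rw [apex, C.φ0_iterate_up hw]
  have h := (Φ.mem_slab.1 hw).1; rw [abs_le] at h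
  push_cast
  omega

/-- The apex has the same `φ₁`. [folklore] -/
theorem φ1_apex {w : V} (hw : w ∈ Φ.slab t ℓ) : Φ.φ (C.apex w) 1 = Φ.φ w 1 := C.φ1_iterate_up hw _

/-- Off the slab the apex is the vertex itself. [folklore] -/
theorem apex_eq_self_of_not_mem {w : V} (hw : w ∉ Φ.slab t ℓ) : C.apex w = w :=
  Function.iterate_fixed (C.up_eq_self_of_not_mem hw) _

/-- **The apex is constant along the up-pointer.** [folklore] -/
theorem apex_up (w : V) : C.apex (C.up w) = C.apex w := by
  by_cases hw : w ∈ Φ.slab t ℓ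
  · have h1 : C.apex (C.up w) = C.up (C.apex w) := by
      rw [apex, apex, ← Function.iterate_succ_apply, Function.iterate_succ_apply']
    rw [h1]
    exact C.up_eq_self_of_ge (C.φ0_apex hw).ge
  · rw [C.up_eq_self_of_not_mem hw]

/-- The apex is constant along iterates of the up-pointer. [folklore] -/
theorem apex_iterate_up (w : V) (k : ℕ) : C.apex (C.up^[k] w) = C.apex w := by
  induction k with
  | zero => rfl
  | succ k ih => rw [Function.iterate_succ_apply', C.apex_up, ih]

/-- **The apex is constant along the matching**: `apex (g v) = apex v`. [folklore] -/
theorem apex_g {v : V} (hv : v ∈ Φ.dom t ℓ) : C.apex (C.g v) = C.apex v := by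
  rw [← C.apex_up (C.g v), C.up_g hv]

/-- The apex of an apex. [folklore] -/
theorem apex_apex (w : V) : C.apex (C.apex w) = C.apex w := C.apex_iterate_up w (2 * ℓ + 4)

/-! ## §3 Threads -/

/-- **UP-THREAD**: from every slab vertex a path to its apex of length `≤ 2ℓ+4`, inside the slab and inside the apex class, with `φ₁`
constant and `φ₀` non-decreasing. [cite: KozmaNitzan2024, §4 p. 26 ((29))] -/
theorem exists_upWalk {w : V} (hw : w ∈ Φ.slab t ℓ) :
    ∃ W : G.Walk w (C.apex w), W.IsPath ∧ W.length ≤ 2 * ℓ + 4 ∧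
      ∀ u ∈ W.support, u ∈ Φ.slab t ℓ ∧ C.apex u = C.apex w ∧ Φ.φ u 1 = Φ.φ w 1 ∧ Φ.φ w 0 ≤ Φ.φ u 0 ∧
        (Φ.φ u 0 = Φ.φ w 0 → u = w) := by
  suffices key : ∀ (n : ℕ) (w : V), w ∈ Φ.slab t ℓ → ((ℓ : ℤ) + 2 - (Φ.φ w 0 - Φ.φ t 0)).toNat = n →
      ∃ W : G.Walk w (C.apex w), W.IsPath ∧ W.length ≤ n ∧
        ∀ u ∈ W.support, u ∈ Φ.slab t ℓ ∧ C.apex u = C.apex w ∧ Φ.φ u 1 = Φ.φ w 1 ∧ Φ.φ w 0 ≤ Φ.φ u 0 ∧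
          (Φ.φ u 0 = Φ.φ w 0 → u = w) by
    obtain ⟨W, hP, hlen, hsup⟩ := key _ w hw rfl
    have h := (Φ.mem_slab.1 hw).1; rw [abs_le] at h
    exact ⟨W, hP, hlen.trans (by omega), hsup⟩
  intro n
  induction n with
  | zero =>
    intro w hw hn
    have h := (Φ.mem_slab.1 hw).1; rw [abs_le] at h
    have hge : (ℓ : ℤ) + 2 ≤ Φ.φ w 0 - Φ.φ t 0 := by omega
    have ha : C.apex w = w := Function.iterate_fixed (C.up_eq_self_of_ge hge) _
    refine ⟨(Walk.nil : G.Walk w w).copy rfl ha.symm, by simp, by simp, fun u hu => ?_⟩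
    simp only [Walk.support_copy, Walk.support_nil, List.mem_singleton] at hu
    subst hu
    exact ⟨hw, rfl, rfl, le_rfl, fun _ => rfl⟩
  | succ n ih =>
    intro w hw hn
    have hlt : Φ.φ w 0 - Φ.φ t 0 < (ℓ : ℤ) + 2 := by omega
    have hu : C.up w ∈ Φ.slab t ℓ := (C.up_mem_dom hw hlt).1
    have hφ := C.φ_up hw hlt
    obtain ⟨W', hP', hlen', hsup'⟩ := ih (C.up w) hu (by omega)
    refine ⟨Walk.cons (C.adj_up hw hlt) (W'.copy rfl (C.apex_up w)), ?_, ?_, ?_⟩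
    · rw [Walk.cons_isPath_iff]
      refine ⟨by simpa using hP', fun hmem => ?_⟩
      rw [Walk.support_copy] at hmem
      have := (hsup' w hmem).2.2.2.1
      omega
    · rw [Walk.length_cons, Walk.length_copy]; omega
    · intro u hu'
      rw [Walk.support_cons, List.mem_cons, Walk.support_copy] at hu'
      rcases hu' with rfl | hu'
      · exact ⟨hw, rfl, rfl, le_rfl, fun _ => rfl⟩
      · obtain ⟨h1, h2, h3, h4, -⟩ := hsup' u hu'
        exact ⟨h1, h2.trans (C.apex_up w), h3.trans hφ.2, by omega, fun h => by omega⟩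

/-- **DOWN-THREAD**: from every slab vertex a path down the matching to the floor `φ₀ − φ₀(t) = −(ℓ+2)`, of length `≤ 2ℓ+4`, inside the slab
and inside the apex class, with `φ₁` constant and `φ₀` non-increasing. [cite: KozmaNitzan2024, §4 p. 26 ((29))] -/
theorem exists_downWalk {w : V} (hw : w ∈ Φ.slab t ℓ) :
    ∃ b, ∃ W : G.Walk w b, Φ.φ b 0 - Φ.φ t 0 = -((ℓ : ℤ) + 2) ∧ W.IsPath ∧ W.length ≤ 2 * ℓ + 4 ∧
      ∀ u ∈ W.support, u ∈ Φ.slab t ℓ ∧ C.apex u = C.apex w ∧ Φ.φ u 1 = Φ.φ w 1 ∧ Φ.φ u 0 ≤ Φ.φ w 0 ∧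
        (Φ.φ u 0 = Φ.φ w 0 → u = w) := by
  suffices key : ∀ (n : ℕ) (w : V), w ∈ Φ.slab t ℓ → (Φ.φ w 0 - Φ.φ t 0 + ((ℓ : ℤ) + 2)).toNat = n →
      ∃ b, ∃ W : G.Walk w b, Φ.φ b 0 - Φ.φ t 0 = -((ℓ : ℤ) + 2) ∧ W.IsPath ∧ W.length ≤ n ∧
        ∀ u ∈ W.support, u ∈ Φ.slab t ℓ ∧ C.apex u = C.apex w ∧ Φ.φ u 1 = Φ.φ w 1 ∧ Φ.φ u 0 ≤ Φ.φ w 0 ∧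
          (Φ.φ u 0 = Φ.φ w 0 → u = w) by
    obtain ⟨b, W, hb, hP, hlen, hsup⟩ := key _ w hw rfl
    have h := (Φ.mem_slab.1 hw).1; rw [abs_le] at h
    exact ⟨b, W, hb, hP, hlen.trans (by omega), hsup⟩
  intro n
  induction n with
  | zero =>
    intro w hw hn
    have h := (Φ.mem_slab.1 hw).1; rw [abs_le] at h
    refine ⟨w, Walk.nil, by omega, by simp, by simp, fun u hu => ?_⟩
    rw [Walk.support_nil, List.mem_singleton] at hu
    subst hu
    exact ⟨hw, rfl, rfl, le_rfl, fun _ => rfl⟩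
  | succ n ih =>
    intro w hw hn
    have hdom : w ∈ Φ.dom t ℓ := ⟨hw, by omega⟩
    have hφ := C.φ_g hdom
    have hg : C.g w ∈ Φ.slab t ℓ := C.g_mem_slab hdom
    obtain ⟨b, W', hb, hP', hlen', hsup'⟩ := ih (C.g w) hg (by omega)
    refine ⟨b, Walk.cons (C.adj_g hdom) W', hb, ?_, ?_, ?_⟩
    · rw [Walk.cons_isPath_iff]
      refine ⟨hP', fun hmem => ?_⟩
      have := (hsup' w hmem).2.2.2.1
      omega
    · rw [Walk.length_cons]; omega
    · intro u hu'
      rw [Walk.support_cons, List.mem_cons] at hu'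
      rcases hu' with rfl | hu'
      · exact ⟨hw, rfl, rfl, le_rfl, fun _ => rfl⟩
      · obtain ⟨h1, h2, h3, h4, -⟩ := hsup' u hu'
        exact ⟨h1, h2.trans (C.apex_g hdom), h3.trans hφ.2, by omega, fun h => by omega⟩

/-- Every slab vertex is within `2ℓ+4` of its apex, by a walk inside the slab. [folklore] -/
theorem exists_walk_apex {w : V} (hw : w ∈ Φ.slab t ℓ) :
    ∃ W : G.Walk w (C.apex w), W.length ≤ 2 * ℓ + 4 ∧ ∀ u ∈ W.support, u ∈ Φ.slab t ℓ := by
  obtain ⟨W, -, hlen, hsup⟩ := C.exists_upWalk hw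
  exact ⟨W, hlen, fun u hu => (hsup u hu).1⟩

end ColData

end PlanarSkeletonFrm

end Summit.CriticalPhenomena.PercolationContinuityZ3.Theorems.Transplant

end
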